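import Mathlib.GroupTheory.SemidirectProduct
import Mathlib.GroupTheory.SpecificGroups.Dihedral
import Mathlib.Algebra.Group.TypeTags.Basic

/-!
# The finite Heisenberg toy `(ℤ/l × ℤ/l) ⋊ D_l` (group-theoretic substrate of a non-vacuity witness for [EtTh] §2)

Mochizuki, *The Étale Theta Function and its Frobenioid-theoretic Manifestations* [EtTh], Publ. RIMS
45 (2009), §2, Def 2.1 – Prop 2.2, PRIMS text pp.35–38 (bib key `MochizukiEtTh2009`): there `Δ̄_X` is
the mod-`l` Heisenberg-type quotient of `Δ_X` with centre `Δ̄_Θ ≅ (ℤ/lℤ)(1)` and `Δ̄^ell_X ≅ (ℤ/lℤ)²`,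
and an inversion acts by `−1` on `Δ̄^ell_X`, `+1` on `Δ̄_Θ` (Rmk 2.1.1 p.36, Prop 2.2 (i) p.37).

This file is PURE FINITE GROUP THEORY (no claim about print): the group `heisPiC l := (ℤ/l × ℤ/l) ⋊ D_l`
where the dihedral group `D_l = ⟨r, s⟩` acts on pairs `(b, c)` by `r^i · (b,c) = (b, c + i b)`,
`s r^i · (b,c) = (−b, c + i b)` (`act`, `theta`); the sign character `sgn`, the rotation index `rotIdx`,
the sign `eps`, and the coordinates `β = b`, `γ = c` with their cocycle rules. The subgroup
`(ℤ/l × ℤ/l) ⋊ ⟨r⟩` is the mod-`l` Heisenberg group (coordinates `a` = rotation index, `b`, `c`).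
Consumer: `ThetaCoversHeisenbergWitness.lean` (a kernel inhabitant of abc-iut-L2-t2's interface
`ThetaCovers.CoverDataAx l`). abc-iut cell, seat abc-iut-w5-d243. [folklore]
-/

namespace Literature.AnabelianGeometry.EtaleTheta

namespace ThetaCovers

namespace HeisenbergWitness

open Multiplicative

variable (l : ℕ)

/-! ## 1. The action of `D_l` on `ℤ/l × ℤ/l` and the group `Π_C` -/

/-- The affine maps `(b, c) ↦ (ε b, c + i b)` of `ℤ/l × ℤ/l` underlying the `D_l`-action. (toy bookkeeping for the typed interface of
[EtTh] Def 2.1 / Prop 2.2; no claim about print) [cite: MochizukiEtTh2009, Def 2.1 p.36] -/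
def actFun (ε i : ZMod l) (p : ZMod l × ZMod l) : ZMod l × ZMod l := (ε * p.1, p.2 + i * p.1)

/-- Composition law of the affine maps: `act(ε,i) ∘ act(ε',j) = act(εε', j + iε')`. (toy bookkeeping for the typed interface of
[EtTh] Def 2.1 / Prop 2.2; no claim about print) [cite: MochizukiEtTh2009, Def 2.1 p.36] -/
theorem actFun_actFun (ε ε' i j : ZMod l) (p : ZMod l × ZMod l) :
    actFun l ε i (actFun l ε' j p) = actFun l (ε * ε') (j + i * ε') p := by
  unfold actFun
  ext <;> simp only <;> ring

/-- `act(1, 0)` is the identity. (toy bookkeeping for the typed interface of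
[EtTh] Def 2.1 / Prop 2.2; no claim about print) [cite: MochizukiEtTh2009, Def 2.1 p.36] -/
theorem actFun_one_zero (p : ZMod l × ZMod l) : actFun l 1 0 p = p := by
  unfold actFun
  ext <;> simp

/-- The affine map `(b, c) ↦ (u b, c + i b)` for a unit `u`, as an automorphism of the multiplicative
copy of `ℤ/l × ℤ/l`. (toy bookkeeping for the typed interface of
[EtTh] Def 2.1 / Prop 2.2; no claim about print) [cite: MochizukiEtTh2009, Def 2.1 p.36] -/
def act (u : (ZMod l)ˣ) (i : ZMod l) : MulAut (Multiplicative (ZMod l × ZMod l)) where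
  toFun x := ofAdd (actFun l (u : ZMod l) i x.toAdd)
  invFun x := ofAdd (actFun l (↑u⁻¹ : ZMod l) (-(i * ↑u⁻¹)) x.toAdd)
  left_inv x := by
    apply toAdd.injective
    simp only [toAdd_ofAdd, actFun_actFun]
    rw [show ((↑u⁻¹ : ZMod l) * ↑u) = 1 from Units.inv_mul u,
      show (i + -(i * (↑u⁻¹ : ZMod l)) * ↑u) = 0 by
        rw [neg_mul, mul_assoc, Units.inv_mul, mul_one, add_neg_cancel],
      actFun_one_zero]
  right_inv x := by
    apply toAdd.injective
    simp only [toAdd_ofAdd, actFun_actFun]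
    rw [show ((↑u : ZMod l) * ↑u⁻¹) = 1 from Units.mul_inv u,
      show (-(i * (↑u⁻¹ : ZMod l)) + i * ↑u⁻¹) = 0 from neg_add_cancel _, actFun_one_zero]
  map_mul' x y := by
    apply toAdd.injective
    simp only [toAdd_ofAdd, toAdd_mul, actFun, Prod.fst_add, Prod.snd_add, Prod.mk_add_mk]
    ext <;> simp only <;> ring

/-- First coordinate of the action: `b ↦ u b`. (toy bookkeeping for the typed interface of
[EtTh] Def 2.1 / Prop 2.2; no claim about print) [cite: MochizukiEtTh2009, Def 2.1 p.36] -/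
@[simp] theorem toAdd_act_fst (u : (ZMod l)ˣ) (i : ZMod l) (x : Multiplicative (ZMod l × ZMod l)) :
    (toAdd (act l u i x)).1 = (u : ZMod l) * (toAdd x).1 := rfl

/-- Second coordinate of the action: `c ↦ c + i b`. (toy bookkeeping for the typed interface of
[EtTh] Def 2.1 / Prop 2.2; no claim about print) [cite: MochizukiEtTh2009, Def 2.1 p.36] -/
@[simp] theorem toAdd_act_snd (u : (ZMod l)ˣ) (i : ZMod l) (x : Multiplicative (ZMod l × ZMod l)) :
    (toAdd (act l u i x)).2 = (toAdd x).2 + i * (toAdd x).1 := rfl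

/-- Composition law in `MulAut`: `act(u,i) * act(u',j) = act(uu', j + iu')`. (toy bookkeeping for the typed interface of
[EtTh] Def 2.1 / Prop 2.2; no claim about print) [cite: MochizukiEtTh2009, Def 2.1 p.36] -/
theorem act_mul_act (u u' : (ZMod l)ˣ) (i j : ZMod l) :
    act l u i * act l u' j = act l (u * u') (j + i * u') := by
  ext x : 1
  apply toAdd.injective
  change actFun l (u : ZMod l) i (actFun l (u' : ZMod l) j x.toAdd) =
    actFun l ((u * u' : (ZMod l)ˣ) : ZMod l) (j + i * u') x.toAdd
  rw [actFun_actFun, Units.val_mul]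

/-- Congruence helper for `act`. (toy bookkeeping for the typed interface of
[EtTh] Def 2.1 / Prop 2.2; no claim about print) [cite: MochizukiEtTh2009, Def 2.1 p.36] -/
theorem act_congr {u u' : (ZMod l)ˣ} {i i' : ZMod l} (hu : u = u') (hi : i = i') :
    act l u i = act l u' i' := by subst hu; subst hi; rfl

/-- The `D_l`-action: rotations `r^i` act by the shears `(b,c) ↦ (b, c + i b)`, reflections `s r^i` by
`(b,c) ↦ (−b, c + i b)`. (toy bookkeeping for the typed interface of
[EtTh] Def 2.1 / Prop 2.2; no claim about print) [cite: MochizukiEtTh2009, Def 2.1 p.36] -/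
def theta : DihedralGroup l →* MulAut (Multiplicative (ZMod l × ZMod l)) where
  toFun g := match g with
    | DihedralGroup.r i => act l 1 i
    | DihedralGroup.sr i => act l (-1) i
  map_one' := by
    rw [DihedralGroup.one_def]
    ext x : 1
    apply toAdd.injective
    change actFun l ((1 : (ZMod l)ˣ) : ZMod l) 0 x.toAdd = x.toAdd
    rw [Units.val_one, actFun_one_zero]
  map_mul' g h := by
    rcases g with i | i <;> rcases h with j | j
    · simp only [DihedralGroup.r_mul_r, act_mul_act]
      exact act_congr l (by simp) (by simp [add_comm])
    · simp only [DihedralGroup.r_mul_sr, act_mul_act]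
      exact act_congr l (by simp) (by simp [sub_eq_add_neg])
    · simp only [DihedralGroup.sr_mul_r, act_mul_act]
      exact act_congr l (by simp) (by simp [add_comm])
    · simp only [DihedralGroup.sr_mul_sr, act_mul_act]
      exact act_congr l (by simp) (by simp [sub_eq_add_neg])

/-- `theta` on a rotation. (toy bookkeeping for the typed interface of
[EtTh] Def 2.1 / Prop 2.2; no claim about print) [cite: MochizukiEtTh2009, Def 2.1 p.36] -/
@[simp] theorem theta_r (i : ZMod l) : theta l (DihedralGroup.r i) = act l 1 i := rfl

/-- `theta` on a reflection. (toy bookkeeping for the typed interface of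
[EtTh] Def 2.1 / Prop 2.2; no claim about print) [cite: MochizukiEtTh2009, Def 2.1 p.36] -/
@[simp] theorem theta_sr (i : ZMod l) : theta l (DihedralGroup.sr i) = act l (-1) i := rfl

/-- **`Π_C` of the toy**: `(ℤ/l × ℤ/l) ⋊ D_l`. (toy bookkeeping for the typed interface of
[EtTh] Def 2.1 / Prop 2.2; no claim about print) [cite: MochizukiEtTh2009, Def 2.1 p.36] -/
abbrev heisPiC : Type := Multiplicative (ZMod l × ZMod l) ⋊[theta l] DihedralGroup l

/-- The sign character of `D_l` (rotations ↦ `0`, reflections ↦ `1`), multiplicatively. (toy bookkeeping for the typed interface of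
[EtTh] Def 2.1 / Prop 2.2; no claim about print) [cite: MochizukiEtTh2009, Def 2.1 p.36] -/
def sgn : DihedralGroup l →* Multiplicative (ZMod 2) where
  toFun g := match g with
    | DihedralGroup.r _ => 1
    | DihedralGroup.sr _ => ofAdd 1
  map_one' := by rw [DihedralGroup.one_def]
  map_mul' g h := by
    rcases g with i | i <;> rcases h with j | j
    · exact (mul_one _).symm
    · exact (one_mul _).symm
    · exact (mul_one _).symm
    · show (1 : Multiplicative (ZMod 2)) = ofAdd 1 * ofAdd 1
      decide

/-- `sgn (r i) = 1`. (toy bookkeeping for the typed interface of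
[EtTh] Def 2.1 / Prop 2.2; no claim about print) [cite: MochizukiEtTh2009, Def 2.1 p.36] -/
@[simp] theorem sgn_r (i : ZMod l) : sgn l (DihedralGroup.r i) = 1 := rfl

/-- `sgn (s r^i) = ofAdd 1 ≠ 1`. (toy bookkeeping for the typed interface of
[EtTh] Def 2.1 / Prop 2.2; no claim about print) [cite: MochizukiEtTh2009, Def 2.1 p.36] -/
@[simp] theorem sgn_sr (i : ZMod l) : sgn l (DihedralGroup.sr i) = ofAdd 1 := rfl

/-- `sgn g = 1` iff `g` is a rotation. (toy bookkeeping for the typed interface of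
[EtTh] Def 2.1 / Prop 2.2; no claim about print) [cite: MochizukiEtTh2009, Def 2.1 p.36] -/
theorem sgn_eq_one_iff (g : DihedralGroup l) : sgn l g = 1 ↔ ∃ i, g = DihedralGroup.r i := by
  rcases g with i | i
  · exact ⟨fun _ => ⟨i, rfl⟩, fun _ => rfl⟩
  · have hne : (ofAdd (1 : ZMod 2) : Multiplicative (ZMod 2)) ≠ 1 := by decide
    refine ⟨fun h => absurd h hne, ?_⟩
    rintro ⟨j, hj⟩
    cases hj

/-- The rotation index `r^i ↦ i` (junk `i` on reflections). (toy bookkeeping for the typed interface of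
[EtTh] Def 2.1 / Prop 2.2; no claim about print) [cite: MochizukiEtTh2009, Def 2.1 p.36] -/
def rotIdx : DihedralGroup l → ZMod l
  | DihedralGroup.r i => i
  | DihedralGroup.sr i => i

/-- `rotIdx (r i) = i`. (toy bookkeeping for the typed interface of
[EtTh] Def 2.1 / Prop 2.2; no claim about print) [cite: MochizukiEtTh2009, Def 2.1 p.36] -/
@[simp] theorem rotIdx_r (i : ZMod l) : rotIdx l (DihedralGroup.r i) = i := rfl

/-- `rotIdx (s r^i) = i`. (toy bookkeeping for the typed interface of
[EtTh] Def 2.1 / Prop 2.2; no claim about print) [cite: MochizukiEtTh2009, Def 2.1 p.36] -/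
@[simp] theorem rotIdx_sr (i : ZMod l) : rotIdx l (DihedralGroup.sr i) = i := rfl

/-- `rotIdx 1 = 0`. (toy bookkeeping for the typed interface of
[EtTh] Def 2.1 / Prop 2.2; no claim about print) [cite: MochizukiEtTh2009, Def 2.1 p.36] -/
@[simp] theorem rotIdx_one : rotIdx l 1 = 0 := rfl

/-- The sign `ε(g) = ±1` by which `g ∈ D_l` acts on the coordinate `b`. (toy bookkeeping for the typed interface of
[EtTh] Def 2.1 / Prop 2.2; no claim about print) [cite: MochizukiEtTh2009, Def 2.1 p.36] -/
def eps : DihedralGroup l → ZMod l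
  | DihedralGroup.r _ => 1
  | DihedralGroup.sr _ => -1

/-- `ε(r^i) = 1`. (toy bookkeeping for the typed interface of
[EtTh] Def 2.1 / Prop 2.2; no claim about print) [cite: MochizukiEtTh2009, Def 2.1 p.36] -/
@[simp] theorem eps_r (i : ZMod l) : eps l (DihedralGroup.r i) = 1 := rfl

/-- `ε(s r^i) = −1`. (toy bookkeeping for the typed interface of
[EtTh] Def 2.1 / Prop 2.2; no claim about print) [cite: MochizukiEtTh2009, Def 2.1 p.36] -/
@[simp] theorem eps_sr (i : ZMod l) : eps l (DihedralGroup.sr i) = -1 := rfl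

/-- `ε(1) = 1`. (toy bookkeeping for the typed interface of
[EtTh] Def 2.1 / Prop 2.2; no claim about print) [cite: MochizukiEtTh2009, Def 2.1 p.36] -/
@[simp] theorem eps_one : eps l 1 = 1 := rfl

/-- `ε(g⁻¹) = ε(g)`. (toy bookkeeping for the typed interface of
[EtTh] Def 2.1 / Prop 2.2; no claim about print) [cite: MochizukiEtTh2009, Def 2.1 p.36] -/
@[simp] theorem eps_inv (g : DihedralGroup l) : eps l g⁻¹ = eps l g := by
  rcases g with i | i <;> rfl

/-- First coordinate of `theta g`: multiplication by `ε(g)`. (toy bookkeeping for the typed interface of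
[EtTh] Def 2.1 / Prop 2.2; no claim about print) [cite: MochizukiEtTh2009, Def 2.1 p.36] -/
@[simp] theorem toAdd_theta_fst (g : DihedralGroup l) (x : Multiplicative (ZMod l × ZMod l)) :
    (toAdd (theta l g x)).1 = eps l g * (toAdd x).1 := by
  rcases g with i | i
  · simp
  · simp

/-- Second coordinate of `theta g`: `c ↦ c + rotIdx(g) · b`. (toy bookkeeping for the typed interface of
[EtTh] Def 2.1 / Prop 2.2; no claim about print) [cite: MochizukiEtTh2009, Def 2.1 p.36] -/
@[simp] theorem toAdd_theta_snd (g : DihedralGroup l) (x : Multiplicative (ZMod l × ZMod l)) :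
    (toAdd (theta l g x)).2 = (toAdd x).2 + rotIdx l g * (toAdd x).1 := by
  rcases g with i | i <;> rfl

/-- The coordinate `b` of an element of `Π_C`. (toy bookkeeping for the typed interface of
[EtTh] Def 2.1 / Prop 2.2; no claim about print) [cite: MochizukiEtTh2009, Def 2.1 p.36] -/
def β (x : heisPiC l) : ZMod l := (toAdd x.left).1

/-- The coordinate `c` of an element of `Π_C`. (toy bookkeeping for the typed interface of
[EtTh] Def 2.1 / Prop 2.2; no claim about print) [cite: MochizukiEtTh2009, Def 2.1 p.36] -/
def γ (x : heisPiC l) : ZMod l := (toAdd x.left).2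

/-- Cocycle rule for `b`: `b(xy) = b(x) + ε(x) b(y)`. (toy bookkeeping for the typed interface of
[EtTh] Def 2.1 / Prop 2.2; no claim about print) [cite: MochizukiEtTh2009, Def 2.1 p.36] -/
@[simp] theorem β_mul (x y : heisPiC l) : β l (x * y) = β l x + eps l x.right * β l y := by
  simp [β, SemidirectProduct.mul_left, toAdd_mul]

/-- Cocycle rule for `c`: `c(xy) = c(x) + c(y) + a(x) b(y)`. (toy bookkeeping for the typed interface of
[EtTh] Def 2.1 / Prop 2.2; no claim about print) [cite: MochizukiEtTh2009, Def 2.1 p.36] -/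
@[simp] theorem γ_mul (x y : heisPiC l) :
    γ l (x * y) = γ l x + (γ l y + rotIdx l x.right * β l y) := by
  simp [γ, β, SemidirectProduct.mul_left, toAdd_mul]

/-- `b(1) = 0`. (toy bookkeeping for the typed interface of
[EtTh] Def 2.1 / Prop 2.2; no claim about print) [cite: MochizukiEtTh2009, Def 2.1 p.36] -/
@[simp] theorem β_one : β l 1 = 0 := by simp [β]

/-- `c(1) = 0`. (toy bookkeeping for the typed interface of
[EtTh] Def 2.1 / Prop 2.2; no claim about print) [cite: MochizukiEtTh2009, Def 2.1 p.36] -/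
@[simp] theorem γ_one : γ l 1 = 0 := by simp [γ]

/-- `b` of an inverse. (toy bookkeeping for the typed interface of
[EtTh] Def 2.1 / Prop 2.2; no claim about print) [cite: MochizukiEtTh2009, Def 2.1 p.36] -/
@[simp] theorem β_inv (x : heisPiC l) : β l x⁻¹ = -(eps l x.right * β l x) := by
  show (toAdd (theta l x.right⁻¹ x.left⁻¹)).1 = _
  rw [toAdd_theta_fst, toAdd_inv, Prod.fst_neg, mul_neg, eps_inv]
  rfl

/-- `c` of an inverse. (toy bookkeeping for the typed interface of
[EtTh] Def 2.1 / Prop 2.2; no claim about print) [cite: MochizukiEtTh2009, Def 2.1 p.36] -/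
@[simp] theorem γ_inv (x : heisPiC l) :
    γ l x⁻¹ = -γ l x - rotIdx l x.right⁻¹ * β l x := by
  show (toAdd (theta l x.right⁻¹ x.left⁻¹)).2 = _
  rw [toAdd_theta_snd, toAdd_inv, Prod.snd_neg, Prod.fst_neg, mul_neg, ← sub_eq_add_neg]
  rfl

/-- `b (inl n) = n.1`. (toy bookkeeping for the typed interface of
[EtTh] Def 2.1 / Prop 2.2; no claim about print) [cite: MochizukiEtTh2009, Def 2.1 p.36] -/
@[simp] theorem β_inl (n : Multiplicative (ZMod l × ZMod l)) :
    β l (SemidirectProduct.inl n) = (toAdd n).1 := rfl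

/-- `c (inl n) = n.2`. (toy bookkeeping for the typed interface of
[EtTh] Def 2.1 / Prop 2.2; no claim about print) [cite: MochizukiEtTh2009, Def 2.1 p.36] -/
@[simp] theorem γ_inl (n : Multiplicative (ZMod l × ZMod l)) :
    γ l (SemidirectProduct.inl n) = (toAdd n).2 := rfl

/-- `b (inr g) = 0`. (toy bookkeeping for the typed interface of
[EtTh] Def 2.1 / Prop 2.2; no claim about print) [cite: MochizukiEtTh2009, Def 2.1 p.36] -/
@[simp] theorem β_inr (g : DihedralGroup l) : β l (SemidirectProduct.inr g) = 0 := by simp [β]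

/-- `c (inr g) = 0`. (toy bookkeeping for the typed interface of
[EtTh] Def 2.1 / Prop 2.2; no claim about print) [cite: MochizukiEtTh2009, Def 2.1 p.36] -/
@[simp] theorem γ_inr (g : DihedralGroup l) : γ l (SemidirectProduct.inr g) = 0 := by simp [γ]

/-- An element of `Π_C` is determined by `(b, c)` and its `D_l`-component. (toy bookkeeping for the typed interface of
[EtTh] Def 2.1 / Prop 2.2; no claim about print) [cite: MochizukiEtTh2009, Def 2.1 p.36] -/
theorem ext_of_coords {x y : heisPiC l} (h1 : x.right = y.right) (h2 : β l x = β l y)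
    (h3 : γ l x = γ l y) : x = y := by
  refine SemidirectProduct.ext ?_ h1
  apply toAdd.injective
  exact Prod.ext h2 h3

/-- … in particular it is `1` iff all three coordinates vanish. (toy bookkeeping for the typed interface of
[EtTh] Def 2.1 / Prop 2.2; no claim about print) [cite: MochizukiEtTh2009, Def 2.1 p.36] -/
theorem eq_one_of_coords {x : heisPiC l} (h1 : x.right = 1) (h2 : β l x = 0) (h3 : γ l x = 0) :
    x = 1 :=
  ext_of_coords l (by simpa using h1) (by simpa using h2) (by simpa using h3)

end HeisenbergWitness

end ThetaCovers

end Literature.AnabelianGeometry.EtaleTheta
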